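import Mathlib

/-!
# Stub `circleZeroCount` of line `Sketch` (skeleton "ResolventCell", gen 2: coarea–Crofton) for crux
`SpectralDefectExtinction.WegnerEstimate` (item stmt-QuantumFields-8966)

Pure matrix algebra: for complex matrices `A` (`N×N`), `B` (`N×r`), `C` (`r×N`) and `r×r` matrices
`δ₀, δ₁, δ₂`, the function `t ↦ det (A + B (δ₀ + cos t · δ₁ + sin t · δ₂) C)` either vanishes identically
or has at most `2r` zeros in `[0, 2π)`.

Proof.  Block determinant (`Matrix.det_fromBlocks_one₂₂`): `det (A + B Δ C) = det [[A, −B], [Δ C, 1]]`.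
Put `z = e^{it}`, so that `z cos t = (z² + 1)/2` and `z sin t = −(i/2)(z² − 1)`; multiplying the last `r`
rows of the block matrix by `z` (i.e. multiplying on the left by `[[1, 0], [0, z·1]]`) gives a matrix whose
entries are polynomials in `z` — constants in the first `N` rows, of degree `≤ 2` in the last `r` rows — so
`z ^ r · det (A + B Δ(t) C) = P(z)` for a polynomial `P ∈ ℂ[X]` with `deg P ≤ 2r` (Leibniz expansion with
a row-wise degree count).  If `P = 0` the determinant vanishes for all real `t` (`z ≠ 0`); otherwise
`t ↦ e^{it}` maps the zero set in `[0, 2π)` injectively (`Circle.exp_injOn_Ico`) into the root set of `P`,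
which has at most `deg P ≤ 2r` elements (`Polynomial.ncard_rootSet_le`).
-/

noncomputable section

namespace Summit.QuantumFields.QCD.Cruxes.WegnerEstimate.ResolventCell

open scoped Matrix BigOperators Polynomial
open Matrix

/-- Row-wise degree count for the determinant of a polynomial matrix: if the entries of row `i` have
degree `≤ d i`, then `deg det M ≤ ∑ i, d i` (Leibniz expansion). -/
private theorem natDegree_det_le_of_row {n : Type*} [Fintype n] [DecidableEq n]
    (M : Matrix n n ℂ[X]) (d : n → ℕ) (hM : ∀ i j, (M i j).natDegree ≤ d i) :
    M.det.natDegree ≤ ∑ i, d i := by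
  rw [Matrix.det_apply]
  refine Polynomial.natDegree_sum_le_of_forall_le _ _ fun σ _ => ?_
  refine (Polynomial.natDegree_smul_le _ _).trans ((Polynomial.natDegree_prod_le _ _).trans ?_)
  calc ∑ i, (M (σ i) i).natDegree ≤ ∑ i, d (σ i) := Finset.sum_le_sum fun i _ => hM _ _
    _ = ∑ i, d i := Equiv.sum_comp σ d

/-- `z cos t = (z² + 1)/2` for `z = e^{it}`. -/
private theorem exp_mul_cos (t : ℝ) :
    (1 / 2 : ℂ) * (Complex.exp (↑t * Complex.I) ^ 2 + 1) =
      Complex.exp (↑t * Complex.I) * ((Real.cos t : ℝ) : ℂ) := by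
  rw [Complex.ofReal_cos, Complex.exp_mul_I]
  linear_combination (-(1 : ℂ) / 2) * Complex.cos_sq_add_sin_sq (t : ℂ) +
    (Complex.sin t ^ 2 / 2) * Complex.I_sq

/-- `z sin t = −(i/2)(z² − 1)` for `z = e^{it}`. -/
private theorem exp_mul_sin (t : ℝ) :
    -(Complex.I / 2) * (Complex.exp (↑t * Complex.I) ^ 2 - 1) =
      Complex.exp (↑t * Complex.I) * ((Real.sin t : ℝ) : ℂ) := by
  rw [Complex.ofReal_sin, Complex.exp_mul_I]
  linear_combination (-Complex.I / 2) * Complex.cos_sq_add_sin_sq (t : ℂ) +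
    (-(Complex.I / 2) * Complex.sin t ^ 2 - Complex.cos t * Complex.sin t) * Complex.I_sq

/-- The algebraic heart: `z ^ r · det (A + B Δ(t) C) = P(z)` at `z = e^{it}` for a polynomial `P` of degree
`≤ 2r` (block determinant with the last `r` rows multiplied by `z`). -/
private theorem exists_poly_det (N r : ℕ) (A : Matrix (Fin N) (Fin N) ℂ) (B : Matrix (Fin N) (Fin r) ℂ)
    (C : Matrix (Fin r) (Fin N) ℂ) (δ₀ δ₁ δ₂ : Matrix (Fin r) (Fin r) ℂ) :
    ∃ P : ℂ[X], P.natDegree ≤ 2 * r ∧ ∀ t : ℝ, P.eval (Complex.exp (↑t * Complex.I)) =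
      Complex.exp (↑t * Complex.I) ^ r *
        (A + B * (δ₀ + ((Real.cos t : ℝ) : ℂ) • δ₁ + ((Real.sin t : ℝ) : ℂ) • δ₂) * C).det := by
  -- `z Δ(t)` as a polynomial matrix in `z`
  obtain ⟨ΔX, hΔX⟩ : ∃ ΔX : Matrix (Fin r) (Fin r) ℂ[X], ΔX =
      (Polynomial.X : ℂ[X]) • δ₀.map Polynomial.C +
        (Polynomial.C (1 / 2 : ℂ) * (Polynomial.X ^ 2 + 1)) • δ₁.map Polynomial.C +
        (Polynomial.C (-(Complex.I / 2)) * (Polynomial.X ^ 2 - 1)) • δ₂.map Polynomial.C := ⟨_, rfl⟩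
  -- the block matrix `[[A, -B], [z Δ(t) C, z · 1]]`
  obtain ⟨M, hM⟩ : ∃ M : Matrix (Fin N ⊕ Fin r) (Fin N ⊕ Fin r) ℂ[X], M =
      Matrix.fromBlocks (A.map Polynomial.C) (-B.map Polynomial.C) (ΔX * C.map Polynomial.C)
        ((Polynomial.X : ℂ[X]) • (1 : Matrix (Fin r) (Fin r) ℂ[X])) := ⟨_, rfl⟩
  have hΔdeg : ∀ i k, (ΔX i k).natDegree ≤ 2 := by
    intro i k
    rw [hΔX]
    simp only [Matrix.add_apply, Matrix.smul_apply, Matrix.map_apply, smul_eq_mul]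
    compute_degree!
  refine ⟨M.det, ?_, fun t => ?_⟩
  · -- degree count: rows `inl _` are constant, rows `inr _` have degree `≤ 2`
    refine (natDegree_det_le_of_row M (Sum.elim (fun _ => 0) (fun _ => 2)) ?_).trans (le_of_eq ?_)
    · rintro (i | i) (j | j)
      · simp [hM]
      · simp [hM]
      · simp only [hM, Matrix.fromBlocks_apply₂₁, Sum.elim_inr, Matrix.mul_apply, Matrix.map_apply]
        exact Polynomial.natDegree_sum_le_of_forall_le _ _ fun k _ =>
          (Polynomial.natDegree_mul_C_le _ _).trans (hΔdeg i k)
      · simp only [hM, Matrix.fromBlocks_apply₂₂, Sum.elim_inr, Matrix.smul_apply, smul_eq_mul]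
        by_cases hij : i = j
        · subst hij
          simp
        · simp [hij]
    · simp [Fintype.sum_sum_type, mul_comm]
  · -- evaluation at `z = e^{it}`
    have hc := exp_mul_cos t
    have hs := exp_mul_sin t
    generalize Complex.exp (↑t * Complex.I) = z at hc hs ⊢
    have hΔ : ΔX.map (Polynomial.eval z) =
        z • (δ₀ + ((Real.cos t : ℝ) : ℂ) • δ₁ + ((Real.sin t : ℝ) : ℂ) • δ₂) := by
      ext i j
      simp only [hΔX, Matrix.map_apply, Matrix.add_apply, Matrix.smul_apply, smul_eq_mul,
        Polynomial.eval_add, Polynomial.eval_sub, Polynomial.eval_mul, Polynomial.eval_pow,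
        Polynomial.eval_X, Polynomial.eval_C, Polynomial.eval_one]
      linear_combination (δ₁ i j) * hc + (δ₂ i j) * hs
    have hA : (A.map Polynomial.C).map (Polynomial.eval z) = A := by
      ext i j; simp
    have hB : (-B.map Polynomial.C).map (Polynomial.eval z) = -B := by
      ext i j; simp
    have hC : (C.map Polynomial.C).map (Polynomial.eval z) = C := by
      ext i j; simp
    have h1 : ((Polynomial.X : ℂ[X]) • (1 : Matrix (Fin r) (Fin r) ℂ[X])).map (Polynomial.eval z) =
        z • (1 : Matrix (Fin r) (Fin r) ℂ) := by
      ext i j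
      by_cases hij : i = j
      · subst hij
        simp
      · simp [hij]
    have hMz : M.map (Polynomial.eval z) =
        Matrix.fromBlocks 1 0 0 (z • (1 : Matrix (Fin r) (Fin r) ℂ)) *
          Matrix.fromBlocks A (-B) ((δ₀ + ((Real.cos t : ℝ) : ℂ) • δ₁ + ((Real.sin t : ℝ) : ℂ) • δ₂) * C) 1 := by
      rw [hM, Matrix.fromBlocks_map, hA, hB, h1, ← Polynomial.coe_evalRingHom, Matrix.map_mul,
        Polynomial.coe_evalRingHom, hΔ, hC, Matrix.fromBlocks_multiply]
      simp only [Matrix.one_mul, Matrix.zero_mul, Matrix.mul_one, add_zero, zero_add, Matrix.smul_mul]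
    rw [← Polynomial.coe_evalRingHom, RingHom.map_det, RingHom.mapMatrix_apply, Polynomial.coe_evalRingHom,
      hMz, Matrix.det_mul, Matrix.det_fromBlocks_zero₂₁, Matrix.det_one, one_mul, Matrix.det_smul,
      Matrix.det_one, mul_one, Fintype.card_fin, Matrix.det_fromBlocks_one₂₂, Matrix.neg_mul,
      sub_neg_eq_add, Matrix.mul_assoc]

/-- Zero count on the circle from a polynomial identity: if `P(e^{it}) = e^{irt} f(t)` for a polynomial `P`
of degree `≤ d`, then either `f` vanishes identically (case `P = 0`) or `f` has at most `d` zeros in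
`[0, 2π)` (injectivity of `t ↦ e^{it}` on `[0, 2π)` and the root count of `P`). -/
private theorem circle_zero_count_of_poly {f : ℝ → ℂ} {P : ℂ[X]} {d r : ℕ} (hdeg : P.natDegree ≤ d)
    (hP : ∀ t : ℝ, P.eval (Complex.exp (↑t * Complex.I)) = Complex.exp (↑t * Complex.I) ^ r * f t) :
    (∀ t, f t = 0) ∨
      ({t : ℝ | t ∈ Set.Ico (0 : ℝ) (2 * Real.pi) ∧ f t = 0}.Finite ∧
        {t : ℝ | t ∈ Set.Ico (0 : ℝ) (2 * Real.pi) ∧ f t = 0}.ncard ≤ d) := by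
  by_cases hP0 : P = 0
  · refine Or.inl fun t => ?_
    have h := hP t
    rw [hP0, Polynomial.eval_zero] at h
    exact (mul_eq_zero.mp h.symm).resolve_left (pow_ne_zero _ (Complex.exp_ne_zero _))
  · right
    have hinj : Set.InjOn (fun t : ℝ => Complex.exp (↑t * Complex.I))
        {t : ℝ | t ∈ Set.Ico (0 : ℝ) (2 * Real.pi) ∧ f t = 0} := by
      intro t₁ h₁ t₂ h₂ h
      exact Circle.exp_injOn_Ico (a := 0) (b := 2 * Real.pi) (by simp) h₁.1 h₂.1 (Circle.ext h)
    have hsub : (fun t : ℝ => Complex.exp (↑t * Complex.I)) ''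
        {t : ℝ | t ∈ Set.Ico (0 : ℝ) (2 * Real.pi) ∧ f t = 0} ⊆ P.rootSet ℂ := by
      rintro _ ⟨t, ht, rfl⟩
      rw [Polynomial.mem_rootSet_of_ne hP0, Polynomial.coe_aeval_eq_eval, hP t, ht.2, mul_zero]
    refine ⟨Set.Finite.of_finite_image ((P.rootSet_finite ℂ).subset hsub) hinj, ?_⟩
    rw [← hinj.ncard_image]
    exact (Set.ncard_le_ncard hsub (P.rootSet_finite ℂ)).trans
      ((Polynomial.ncard_rootSet_le P ℂ).trans hdeg)

/-- **Stub `circleZeroCount` (algebra; level sets meet one-link circles at most `2r` times).**  For square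
matrices `A` (`N×N`), `B` (`N×r`), `C` (`r×N`) and `r×r` matrices `δ₀, δ₁, δ₂`, the function
`t ↦ det(A + B (δ₀ + cos t · δ₁ + sin t · δ₂) C)` is either identically zero or has at most `2r` zeros in
`[0, 2π)`.  (Block determinant `det(A + BΔC) = det [[A, −B],[ΔC, 1]]` is a polynomial of degree `≤ r` in the entries
of `Δ`; a trigonometric polynomial of degree `≤ r` is `e^{−irt}·p(e^{it})` with `deg p ≤ 2r`.)  Used with `r = 24`:
rotating ONE link moves `Γ₅D_W` in two `12×12` blocks. -/
theorem stub_circleZeroCount :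
    ∀ (N r : ℕ) (A : Matrix (Fin N) (Fin N) ℂ) (B : Matrix (Fin N) (Fin r) ℂ) (C : Matrix (Fin r) (Fin N) ℂ)
      (δ₀ δ₁ δ₂ : Matrix (Fin r) (Fin r) ℂ),
      (∀ t : ℝ, (A + B * (δ₀ + ((Real.cos t : ℝ) : ℂ) • δ₁ + ((Real.sin t : ℝ) : ℂ) • δ₂) * C).det = 0) ∨
      ({t : ℝ | t ∈ Set.Ico (0 : ℝ) (2 * Real.pi) ∧
          (A + B * (δ₀ + ((Real.cos t : ℝ) : ℂ) • δ₁ + ((Real.sin t : ℝ) : ℂ) • δ₂) * C).det = 0}.Finite ∧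
        {t : ℝ | t ∈ Set.Ico (0 : ℝ) (2 * Real.pi) ∧
          (A + B * (δ₀ + ((Real.cos t : ℝ) : ℂ) • δ₁ + ((Real.sin t : ℝ) : ℂ) • δ₂) * C).det = 0}.ncard ≤ 2 * r) := by
  intro N r A B C δ₀ δ₁ δ₂
  obtain ⟨P, hdeg, hev⟩ := exists_poly_det N r A B C δ₀ δ₁ δ₂
  exact circle_zero_count_of_poly
    (f := fun t => (A + B * (δ₀ + ((Real.cos t : ℝ) : ℂ) • δ₁ + ((Real.sin t : ℝ) : ℂ) • δ₂) * C).det)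
    hdeg hev

end Summit.QuantumFields.QCD.Cruxes.WegnerEstimate.ResolventCell

end
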